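import Summits.CriticalPhenomena.PercolationContinuityZ3.Theorems.SahiMasterFamilyFCrossInduction
import Summits.CriticalPhenomena.PercolationContinuityZ3.Theorems.SahiMasterFamilyEqPrincipal
import Mathlib.Tactic.Linarith
import Mathlib.Tactic.Ring
import HarnessLib

/-!
# The `F`-inequality of the 0-minor core: the induction may always split along a coordinate of `A` or `B`

Support file (cell `prim-bnk`, seat bnk-2 gen 18; `--supports stmt-CriticalPhenomena-4575`; memo
`run/shared/lean/prim/prim-l12/FROM-prim-bnk-2-g18-FCOMB-CENSUS.md` §8).  No definition, no `sorry`, standard axioms.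

`SahiFInduction.F_nonneg_of_exists_cross_step` proves `F(A,B;G) ≥ 0` for all increasing triples from: for every increasing triple
with an essential coordinate, SOME essential coordinate `e` has cross coefficient `X_e ≥ 0` (given `F ≥ 0` one total-support step down).
The exhaustive per-instance LP census of the memo (§8(a)) shows that the natural certificate for `X_e` (cells + Harris + `F` one
dimension down) fails ONLY along coordinates that neither `A` nor `B` sees — and this file records that such coordinates are never
needed: if `A` (or `B`) has no essential coordinate it is `∅` or `univ` and `F` is `0` or a Harris covariance
(`F_nonneg_of_esupp_left_eq_empty`, `F_nonneg_of_esupp_right_eq_empty`), so the skeleton only has to be fed cross coefficients along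
`e ∈ esupp A ∪ esupp B` (`F_nonneg_of_cross_step_AB`).  HONEST FRAMING: a conditional reduction; `F ≥ 0` itself remains OPEN. [this work]
-/

noncomputable section

open scoped Classical

namespace Summit.CriticalPhenomena.PercolationContinuityZ3.Theorems

namespace SahiFInduction

open Finset Function
open Literature.Combinatorics.Sahi2008
open Literature.Probability.Percolation.DecisionTree (ind ind_of_mem ind_of_not_mem ind_nonneg)

variable {κ : Type} [Fintype κ]

local notation3 (prettyPrint := false) "μ⟦" p ", " X "⟧" => ex (bernoulliWeight p) (ind X)

/-- `F(A,B;G) ≥ 0` when `A` has no essential coordinate: then `A = ∅` (and `F = 0`) or `A = univ` (and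
`F = μ(B∩G) − μ(G)μ(B) ≥ 0` by Harris). [this work] -/
theorem F_nonneg_of_esupp_left_eq_empty (p : κ → unitInterval) {A B G : Set (Set κ)}
    (hA : IsUpperSet A) (hB : IsUpperSet B) (hG : IsUpperSet G) (h0 : esupp A = ∅) :
    0 ≤ (1 + μ⟦p, G⟧) * μ⟦p, A ∩ B ∩ G⟧ - μ⟦p, G⟧ * μ⟦p, A ∩ B⟧ - μ⟦p, A ∩ G⟧ * μ⟦p, B ∩ G⟧ := by
  rcases eq_empty_or_univ_of_esupp_eq_empty hA h0 with rfl | rfl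
  · simp [SahiCombDisjunct.ex_ind_empty]
  · simp only [Set.univ_inter]
    have hH := harris_ex_ind p hB hG
    have hH' := harris_ex_ind p hG hB
    rw [Set.inter_comm] at hH'
    nlinarith [hH, hH']

/-- `F(A,B;G) ≥ 0` when `B` has no essential coordinate (symmetric to `F_nonneg_of_esupp_left_eq_empty`). [this work] -/
theorem F_nonneg_of_esupp_right_eq_empty (p : κ → unitInterval) {A B G : Set (Set κ)}
    (hA : IsUpperSet A) (hB : IsUpperSet B) (hG : IsUpperSet G) (h0 : esupp B = ∅) :
    0 ≤ (1 + μ⟦p, G⟧) * μ⟦p, A ∩ B ∩ G⟧ - μ⟦p, G⟧ * μ⟦p, A ∩ B⟧ - μ⟦p, A ∩ G⟧ * μ⟦p, B ∩ G⟧ := by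
  have h := F_nonneg_of_esupp_left_eq_empty p hB hA hG h0
  rw [Set.inter_comm B A] at h
  linarith [h]

omit [Fintype κ] in
/-- Sections of the empty event are empty. [folklore] -/
theorem secAt_empty_eq (e : κ) (b : Bool) : secAt e b (∅ : Set (Set κ)) = ∅ := by
  ext ω
  simp [mem_secAt]

omit [Fintype κ] in
/-- Sections of the sure event are sure. [folklore] -/
theorem secAt_univ_eq (e : κ) (b : Bool) : secAt e b (Set.univ : Set (Set κ)) = Set.univ := by
  ext ω
  simp [mem_secAt]

/-- **The induction skeleton for `F`, fed only along coordinates of `A` or `B`.**  If for every triple of increasing events and every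
coordinate `e` essential to `A` OR to `B` the cross Bernstein coefficient `X_e` is `≥ 0` whenever `F ≥ 0` holds for all increasing
triples of smaller total essential support, then `F ≥ 0` for every increasing triple.  (Via `F_nonneg_of_exists_cross_step`: when
`esupp A = esupp B = ∅` both events are `∅` or `univ` and every cross coefficient vanishes.)  This is the form the per-instance
certificates of the memo (§8: cells + Harris + `F(A⁰,B⁰;G⁰)`, `F(A¹,B¹;G¹)` with multipliers in `[0,1]`) would discharge. [this work] -/
theorem F_nonneg_of_cross_step_AB (p : κ → unitInterval)
    (hstep : ∀ (A B G : Set (Set κ)) (e : κ), IsUpperSet A → IsUpperSet B → IsUpperSet G →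
      (e ∈ esupp A ∨ e ∈ esupp B) →
      (∀ (A' B' G' : Set (Set κ)), IsUpperSet A' → IsUpperSet B' → IsUpperSet G' →
        (esupp A').card + (esupp B').card + (esupp G').card < (esupp A).card + (esupp B).card + (esupp G).card →
        0 ≤ (1 + μ⟦p, G'⟧) * μ⟦p, A' ∩ B' ∩ G'⟧ - μ⟦p, G'⟧ * μ⟦p, A' ∩ B'⟧ - μ⟦p, A' ∩ G'⟧ * μ⟦p, B' ∩ G'⟧) →
      0 ≤ μ⟦p, secAt e true A ∩ secAt e true B ∩ secAt e true G⟧ + μ⟦p, secAt e false A ∩ secAt e false B ∩ secAt e false G⟧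
            + μ⟦p, secAt e true G⟧ * μ⟦p, secAt e false A ∩ secAt e false B ∩ secAt e false G⟧
            + μ⟦p, secAt e false G⟧ * μ⟦p, secAt e true A ∩ secAt e true B ∩ secAt e true G⟧
            - μ⟦p, secAt e true G⟧ * μ⟦p, secAt e false A ∩ secAt e false B⟧
            - μ⟦p, secAt e false G⟧ * μ⟦p, secAt e true A ∩ secAt e true B⟧
            - μ⟦p, secAt e true A ∩ secAt e true G⟧ * μ⟦p, secAt e false B ∩ secAt e false G⟧
            - μ⟦p, secAt e false A ∩ secAt e false G⟧ * μ⟦p, secAt e true B ∩ secAt e true G⟧) :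
    ∀ (A B G : Set (Set κ)), IsUpperSet A → IsUpperSet B → IsUpperSet G →
      0 ≤ (1 + μ⟦p, G⟧) * μ⟦p, A ∩ B ∩ G⟧ - μ⟦p, G⟧ * μ⟦p, A ∩ B⟧ - μ⟦p, A ∩ G⟧ * μ⟦p, B ∩ G⟧ := by
  apply F_nonneg_of_exists_cross_step p
  intro A B G hA hB hG hpos ih
  by_cases hA0 : esupp A = ∅
  · by_cases hB0 : esupp B = ∅
    · -- both `A` and `B` are `∅` or `univ`: every cross coefficient vanishes; take any essential coordinate of `G`
      have hG0 : (esupp G).Nonempty := by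
        rw [hA0, hB0, Finset.card_empty, zero_add, zero_add, Finset.card_pos] at hpos
        exact hpos
      obtain ⟨e, he⟩ := hG0
      refine ⟨e, Or.inr (Or.inr he), ?_⟩
      rcases eq_empty_or_univ_of_esupp_eq_empty hA hA0 with rfl | rfl
      · simp [secAt_empty_eq, SahiCombDisjunct.ex_ind_empty]
      · rcases eq_empty_or_univ_of_esupp_eq_empty hB hB0 with rfl | rfl
        · simp [secAt_empty_eq, SahiCombDisjunct.ex_ind_empty]
        · simp only [secAt_univ_eq, Set.univ_inter, SahiCombDisjunct.ex_ind_univ]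
          nlinarith
    · obtain ⟨e, he⟩ := Finset.nonempty_iff_ne_empty.2 hB0
      exact ⟨e, Or.inr (Or.inl he), hstep A B G e hA hB hG (Or.inr he) ih⟩
  · obtain ⟨e, he⟩ := Finset.nonempty_iff_ne_empty.2 hA0
    exact ⟨e, Or.inl he, hstep A B G e hA hB hG (Or.inl he) ih⟩

end SahiFInduction

end Summit.CriticalPhenomena.PercolationContinuityZ3.Theorems
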